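import Summits.QuantumFields.YangMills.Theorems.BalabanLadderIRPinnedExitCofinal
import Summits.QuantumFields.YangMills.Theorems.BalabanLadderIRRankPurityCofinal
import Summits.QuantumFields.YangMills.Theorems.BalabanLadderIRTwistCostOfPurity
import Summits.QuantumFields.YangMills.Theorems.BalabanLadderIRColdPurityDobrushinCorner
import Summits.QuantumFields.YangMills.Theorems.BalabanLadderIRAfOnsetLatticeAF
import Summits.QuantumFields.YangMills.Theses.BalabanLadder
import HarnessLib

/-!
# Crux `IRcof` (stmt-QuantumFields-26930) — LINE `uv-pin` rev 1 (count of record: a SPLIT of line `deconfinement-ruler` at its (CU) node; ideator ym-ir-idea-21 g0, lens `barrier`; technique: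
# inversion of the FLOOR negatives p624174 `not_pinnedExitsCofinalFree` ∕ p630186 `IR*_false_without_LowerBounds`)
# `PXcof(1∕24) ⇐ (C) ConfinedAtEveryCoupling(1∕12) ∧ (A) AFBelowConfinement(1∕12) ∧ (G) ConfinedToPure(1∕12,1∕24) ∧ (CF)`, then the slot's bill

TOKEN ASSEMBLY (D-0146) onto the slot of record rev 2 `Cruxes/IRcof/Lines/pinned_cofinal_bill.lean` (ce8a790cd962) {PXcof(1∕24), N_cof}: this
file PRODUCES `PinnedExitsCofinalAt (1/24)` (verbatim copy, §0) and concludes `Summit.QuantumFields.YangMills.Theses.BalabanLadder.IRcof` LITERALLY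
(`IRcof_of_stubs`), N_cof = `RankPurity.IRnscCof` BY NAME.  On the way it PRODUCES line `deconfinement-ruler`'s token (CU)
`PinnedConfinedCofinal (1/12)` (verbatim copy, `pinnedConfinedCofinal_of_pincer`), so the two lines of this seat are kernel-compatible.

THE LEVER (barrier-inversion of the floor negatives; rev 1 wording after crit-3's verdict — see REVISION below).  The tree's floor negatives say
«any proof of PXcof ∕ IRcof must CONSUME `LowerBounds G r a`» (at `slowUnit a = 1∕√(β ∨ 1)` the floor-free statement is false).  The statement JUST
OUTSIDE that class is the one in which the floor is consumed by EXACTLY ONE implication and everything else is floor-free AND unit-free.  With the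
deconfinement ruler `MarginConfinedAt` (line `deconfinement-ruler`, same def, token-identical) as the intrinsic unit, the floor's only job is to
COMPARE TWO LENGTHS at one coupling: the floor length `n_ε⁻(β)` (shortest separation at which `Q2 ≥ ε`) and the confinement length `L_conf(β)`.
(A) asserts `L_conf ≤ M·n_ε⁻` uniformly in `β` — PROMPT CONFINEMENT in floor units — and the PROVED seam `floorPins_of_af` turns that into PXcof's
pin `a(β)·L' ≤ T` pointwise in `β`; no scaling function, no `a_phys(β)` formula, no RG-diagonal transport, the confinement scale being a HYPOTHESIS
scale read off the twist ratios.  This moves the af-pincer architecture (19354: K1 `RankExitsUnbounded` ∧ X `AFToRankExit`, onset = a purity ∕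
mixing length) DOWN from the purity onset to the CONFINEMENT onset: both clauses get weaker ((C) ≤ E-type, (A) ≤ X-type, since pure ⇒ confined at
the same scale by S1 and `L_conf ≤ L_pure`), and the price is exactly line 1's located residual (G).

REVISION (rev 1, 2026-08-28 ≥ 17:50Z; crit-3 g3 VERDICT 17:38:06Z «PASS-WITH-PRICE as a SPLIT of LINE 1's (CU) node; (A) is NOT a UV lemma»,
accepted in full).  rev 0 labelled (A) «asymptotic freedom below the confinement scale ∕ Balaban-programme UV content (R4's side)».  That was the
wrong ledger: AF gives `Q2` small only where `g_eff` is small and says nothing about WHERE confinement sits relative to that scale; the load of (A) is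
the IR statement `L_conf ≤ M·n_ε⁻` (X-family, rows 26∕36 re-based; row 11 T1), necessary for PXcof.  Count of record: this file is a SPLIT of line
`deconfinement-ruler`'s (CU) node — (CU) ↦ (C) ∧ (A) through the floor — not a second line.  Statements and proofs are UNCHANGED from rev 0
(665eb58187b1); only labels changed.  Bookable anatomy (crit-3): PXcof ⊇ {confinement (C)-cofinal, promptness ∕ units (A), confinement → purity (G),
centre-free (CF)} with kernel seams `floorPins_of_af` ∕ `pinnedConfinedCofinal_of_pincer` ∕ `pxcof_of_ruler`.

THE CUT.  PXcof(θ) ⇐ (C)(η) ∧ (A)(η) ∧ (G)(η,θ) ∧ (CF)(θ)  [`pxcof_of_uvpin`, PROVED], through two PROVED seams: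
* `floorPins_of_af` : (A)(η) ⇒ (X_conf)(η) `FloorPinsConfinementOnset η` — the floor-consuming step, ~20 lines of logic: at a coupling where some
  thick box is margin-confined but none fits under the pin `T = M`, (A) puts `Q2 < ε` on every large torus at unit `a(β)`, contradicting clause (i) of
  `LowerBounds`;
* `pinnedConfinedCofinal_of_pincer` : (C) ∧ (X_conf) ⇒ (CU) (line 1's token), and then line 1's assembly `(CU) ∧ (G) ∧ (CF) ⇒ PXcof` (re-proved here).
Statements:
* (C) `ConfinedAtEveryCoupling η` — Wilson's confinement problem in finite-box twist currency, UNIT-FREE, FLOOR-FREE, RATE-FREE: for simply-connected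
  simple `G` with non-trivial centre, every `r`, every `β ≥ 0`, SOME thick `4:1` box `L ≥ 8` is `η`-margin-confined.  PROVED in the Dobrushin corner
  (`confinedAtEveryCoupling_rung_dobrushin`: `0 ≤ β ≤ 1∕(216N)` ⇒ every `L ≥ max L₀ 8` is `1∕12`-margin-confined, from S1 + the landed cold-purity
  corner — a hypothesis-USING in-regime rung).  OPEN at weak coupling (the classical wall; no tool claimed).
* (A) `AFBelowConfinement η` — UV CONTROL ∧ PROMPT CONFINEMENT IN FLOOR UNITS (rev 1 label): for every `v` (positive-time support) and `ε > 0`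
  there are `M, Λ, β₀` such that at every `β ≥ β₀` and every unit `s > 0` at which some thick box is margin-confined and EVERY margin-confined thick
  box has `s·L' ≥ M` (the unit is coarser than `M` confinement units), `Q2(β, L, s; θv, v) < ε` on every torus with `s·L ≥ Λ`; equivalently
  `L_conf(β) ≤ M·n_ε⁻(β)` uniformly in `β`.  IR content (X-family re-based at the confinement onset), necessary for PXcof, summit-adjacent; the
  tree PROVES the unit-bounded-below case (`AfOnset.exists_abs_Q2_le_log_sq`, `exists_beta_forall_abs_Q2_le`) ⇒ PROVED format rung
  `afBelowConfinement_rung_bddOnset` (bounded confinement onset).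
* (G) `ConfinedToPure η θ`, (CF) `PinnedExitsCofinalCentreFreeAt θ` — verbatim from line `deconfinement-ruler` (token-identical).
Registered: `η = 1∕12`, `θ = 1∕24`.  Five stubs: (C), (A), (G), (CF), N_cof.

NECESSITY ∕ STRENGTH.  (X_conf) and hence nothing stronger than needed on the floor side: PXcof(θ) ⇒ (CU)(2θ) (line 1, S1) and (CU) ⇒ the
CONCLUSION of (X_conf) cofinally; (A) is a floor-free statement about `Q2` vs the ruler (no `coldDefect` in it; its promptness content is necessary for PXcof, see (A)'s docstring); (C) is `∀ β` where PXcof is cofinal — the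
one place this line asks MORE than PXcof needs, deliberately: confinement at every coupling is the natural statement and the only form in which the
pincer closes by modus ponens at the SAME coupling (cofinal ∧ cofinal ≠ cofinal).

BARRIER PLACEMENT.  Floor negatives p624174 ∕ p630186: honoured by construction — the floor is consumed (quantitatively, as an UPPER bound on the unit
in confinement units) inside `floorPins_of_af`; (C), (G) are floor-free and unit-free, (CF) keeps the floor verbatim.  `not_uniformExit24_holds` ∕
`pure_box_is_long_holds` (p621160): no statement fixes a box before the coupling except (G) under its margin hypothesis (refuted in the heavy-twist
window ⇒ vacuous there, as in line 1).  FiniteTemperatureDeconfinement (BS83): (C) asks SOME thick box per coupling (large `L` allowed), never a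
temperature-blind claim.  AbelianDeconfinementD4 ∕ MigdalKadanoff group-blindness: (C) is FALSE for `U(1)₄` (Coulomb: twist ratio `≈ e^{−2βα²}`),
i.e. the carrier is not group-blind; (A) is VACUOUS-not-blind on `U(1)₄` at weak coupling (its hypothesis «some thick box margin-confined» fails in
the Coulomb phase) and carries promptness, not confinement or gap, where it binds.  DiscreteSubgroupFreezing ∕
EguchiKawai ∕ DiluteInstantonGas: not in class.  RG-diagonal census rule (K-v4.0-10): (A) has ONE coupling and no transport in `β`; the running is
in the SEPARATION at fixed `β`, below a hypothesis scale.

HONEST LABEL.  Nothing here proves the Yang–Mills mass gap (Clay), a lattice gap, confinement at weak coupling, `IRcof`, `IR`, or any slot token;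
`IRcof` 0∕1; R2c IDEA-BOUND; R4 = `BalabanLadder.UV` only.  The sorried declarations are exactly the five `stub_*`.  MC numbers quoted in the card are
GUIDANCE.
-/

set_option autoImplicit false

noncomputable section

open Filter Topology MeasureTheory
open scoped SchwartzMap
open Literature.MathematicalPhysics.QuantumFieldTheory Literature.MathematicalPhysics.QuantumLattice
open Summit.QuantumFields.YangMills.Cruxes.OSLegsFromFemtoAndGap.DlrCollarTransfer (LowerBounds Q2)
open Summit.QuantumFields.YangMills.Cruxes.IR.ColdPurityBridge (coldDefect)
open Summit.QuantumFields.YangMills.Cruxes.IR.RankPurity (IRnscCof IRcof_of_split)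
open Summit.QuantumFields.YangMills.Cruxes.IR.PinnedExitCofinal (ircofSC_of_pinnedExitsCofinal_le)
open Summit.QuantumFields.YangMills.Cruxes.IR.TwistCost (half_twist_cost_le_coldDefect)
open Summit.QuantumFields.YangMills.Cruxes.IR.ColdPurityDobrushin (coldExitAt_corner_of_dobrushinTV)
open Summit.QuantumFields.YangMills.Cruxes.IR.AfOnset (exists_beta_forall_abs_Q2_le)

namespace Summit.QuantumFields.YangMills.Cruxes.IRcof.UvPin

/-! ## §0 Tokens, verbatim: the slot's PXcof(θ); line 1's ruler `MarginConfinedAt`, (CU), (G), (CF) -/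

/-- **PXcof(θ)** — verbatim copy of the slot's `PinnedCofinalBill.PinnedExitsCofinalAt θ` (ce8a790cd962). -/
def PinnedExitsCofinalAt (θ : ℝ) : Prop :=
  ∀ (G : Type) [Group G] [TopologicalSpace G] [IsTopologicalGroup G] [CompactSpace G],
    IsCompactSimpleLieGroup G → SimplyConnectedSpace G →
    letI : MeasurableSpace G := borel G
    haveI : BorelSpace G := ⟨rfl⟩
    ∀ (r : LatticeRep G) (a : ℝ → ℝ), (∀ β, 0 < a β) → Tendsto a atTop (𝓝 0) → LowerBounds G r a →
      ∃ T : ℝ, ∀ β₁ : ℝ, ∃ β : ℝ, β₁ ≤ β ∧ ∃ L : ℕ, 8 ≤ L ∧ a β * (L : ℝ) ≤ T ∧ coldDefect r.ρ β L ≤ θ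

section Ruler

variable {G : Type} [Group G] [TopologicalSpace G] [IsTopologicalGroup G] [CompactSpace G]
  [MeasurableSpace G] [BorelSpace G] {N : ℕ}

/-- **`η`-margin-confined thick box** — verbatim copy of `DeconfinementRuler.MarginConfinedAt` (line 1, 095381460304; token-identical). -/
def MarginConfinedAt (ρ : G →* Matrix (Fin N) (Fin N) ℂ) (β : ℝ) (L : ℕ) (η : ℝ) : Prop :=
  ∀ z : Fin 4 → G, (∀ μ, z μ ∈ Subgroup.center G) →
    1 - wilsonFinTorusTwistedPartition ρ β z L L L (L / 4) / wilsonFinTorusPartition ρ β L L L (L / 4) ≤ η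

end Ruler

/-- **(CU)** — verbatim copy of `DeconfinementRuler.PinnedConfinedCofinal` (line 1's token; PRODUCED here by `pinnedConfinedCofinal_of_pincer`). -/
def PinnedConfinedCofinal (η : ℝ) : Prop :=
  ∀ (G : Type) [Group G] [TopologicalSpace G] [IsTopologicalGroup G] [CompactSpace G],
    IsCompactSimpleLieGroup G → SimplyConnectedSpace G →
    letI : MeasurableSpace G := borel G
    haveI : BorelSpace G := ⟨rfl⟩
    ∀ (r : LatticeRep G) (a : ℝ → ℝ), (∀ β, 0 < a β) → Tendsto a atTop (𝓝 0) → LowerBounds G r a →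
      ∃ T : ℝ, ∀ β₁ : ℝ, ∃ β : ℝ, β₁ ≤ β ∧ ∃ L : ℕ, 8 ≤ L ∧ a β * (L : ℝ) ≤ T ∧ MarginConfinedAt r.ρ β L η

/-- **(G)** — verbatim copy of `DeconfinementRuler.ConfinedToPure` (line 1's located residual; token-identical). -/
def ConfinedToPure (η θ : ℝ) : Prop :=
  ∀ (G : Type) [Group G] [TopologicalSpace G] [IsTopologicalGroup G] [CompactSpace G],
    IsCompactSimpleLieGroup G → SimplyConnectedSpace G → (∃ z : G, z ∈ Subgroup.center G ∧ z ≠ 1) →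
    letI : MeasurableSpace G := borel G
    haveI : BorelSpace G := ⟨rfl⟩
    ∀ r : LatticeRep G, ∃ κ : ℕ, ∃ β₀ : ℝ, 1 ≤ κ ∧ ∀ β : ℝ, β₀ ≤ β → ∀ L : ℕ, 8 ≤ L →
      MarginConfinedAt r.ρ β L η → coldDefect r.ρ β (κ * L) ≤ θ

/-- **(CF)** — verbatim copy of `DeconfinementRuler.PinnedExitsCofinalCentreFreeAt` (PXcof on the centre-free class; token-identical). -/
def PinnedExitsCofinalCentreFreeAt (θ : ℝ) : Prop :=
  ∀ (G : Type) [Group G] [TopologicalSpace G] [IsTopologicalGroup G] [CompactSpace G],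
    IsCompactSimpleLieGroup G → SimplyConnectedSpace G → (∀ z : G, z ∈ Subgroup.center G → z = 1) →
    letI : MeasurableSpace G := borel G
    haveI : BorelSpace G := ⟨rfl⟩
    ∀ (r : LatticeRep G) (a : ℝ → ℝ), (∀ β, 0 < a β) → Tendsto a atTop (𝓝 0) → LowerBounds G r a →
      ∃ T : ℝ, ∀ β₁ : ℝ, ∃ β : ℝ, β₁ ≤ β ∧ ∃ L : ℕ, 8 ≤ L ∧ a β * (L : ℝ) ≤ T ∧ coldDefect r.ρ β L ≤ θ

/-! ## §1 The statements of this line -/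

/-- **(C) `ConfinedAtEveryCoupling η` — CONFINEMENT AT EVERY COUPLING, finite-box twist currency (unit-free, floor-free, rate-free).**
For simply-connected compact simple `G` with non-trivial centre, every `r` and every `β ≥ 0` there is a thick `4:1` box `L³×⌊L∕4⌋`, `L ≥ 8`, all of
whose central temporal twists cost at most `η·Z`.  Why it might fail: a deconfined (Coulomb-like) window of couplings for some `(G, r)` — none is
expected for any simple `G` (bulk transitions of mixed ∕ large-`N` actions separate two CONFINING regimes), but at weak coupling this is Wilson's
confinement problem and nothing in print proves it in `d = 4`.  PROVED for `0 ≤ β ≤ 1∕(216N)` (`confinedAtEveryCoupling_rung_dobrushin`). -/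
def ConfinedAtEveryCoupling (η : ℝ) : Prop :=
  ∀ (G : Type) [Group G] [TopologicalSpace G] [IsTopologicalGroup G] [CompactSpace G],
    IsCompactSimpleLieGroup G → SimplyConnectedSpace G → (∃ z : G, z ∈ Subgroup.center G ∧ z ≠ 1) →
    letI : MeasurableSpace G := borel G
    haveI : BorelSpace G := ⟨rfl⟩
    ∀ (r : LatticeRep G) (β : ℝ), 0 ≤ β → ∃ L : ℕ, 8 ≤ L ∧ MarginConfinedAt r.ρ β L η

/-- **(X_conf) `FloorPinsConfinementOnset η` — THE PIN, pointwise in the coupling (DERIVED from (A) by `floorPins_of_af`; not a stub).**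
For simply-connected simple `G` with non-trivial centre, every `r`, every positive unit map `a → 0` WITH the floor `LowerBounds G r a`: `∃ T β₀ ∀ β ≥ β₀`,
whenever some thick box is `η`-margin-confined at `β`, one such box `L'` has `a(β)·L' ≤ T`. -/
def FloorPinsConfinementOnset (η : ℝ) : Prop :=
  ∀ (G : Type) [Group G] [TopologicalSpace G] [IsTopologicalGroup G] [CompactSpace G],
    IsCompactSimpleLieGroup G → SimplyConnectedSpace G → (∃ z : G, z ∈ Subgroup.center G ∧ z ≠ 1) →
    letI : MeasurableSpace G := borel G
    haveI : BorelSpace G := ⟨rfl⟩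
    ∀ (r : LatticeRep G) (a : ℝ → ℝ), (∀ β, 0 < a β) → Tendsto a atTop (𝓝 0) → LowerBounds G r a →
      ∃ T β₀ : ℝ, ∀ β : ℝ, β₀ ≤ β → ∀ L : ℕ, 8 ≤ L → MarginConfinedAt r.ρ β L η →
        ∃ L' : ℕ, 8 ≤ L' ∧ MarginConfinedAt r.ρ β L' η ∧ a β * (L' : ℝ) ≤ T

/-- **(A) `AFBelowConfinement η` — rev 1 label (crit-3 g3 verdict 17:38:06Z accepted): UV CONTROL ∧ PROMPT CONFINEMENT IN FLOOR UNITS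
(no unit map, no floor, one coupling at a time; decl name kept from rev 0).**  For simply-connected simple `G` with non-trivial centre, every `r`,
every real test function `v` with positive-time support and every `ε > 0` there are `M, Λ, β₀` with: at every `β ≥ β₀` and every unit `s > 0` such
that SOME thick box is `η`-margin-confined at `β` and EVERY `η`-margin-confined thick box `L'` has `M ≤ s·L'` (the unit is at least `M` confinement
units coarse), the floor functional is small: `Q2 G r β L s (θv) v < ε` for every torus with `Λ ≤ s·L`.
WHAT IT SAYS (the critic's reformulation, adopted): with `n_ε⁻(β)` := the shortest separation scale `1∕s` at which the floor functional reaches `ε`,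
(A) ⇔ `L_conf(β) ≤ M·n_ε⁻(β)` UNIFORMLY in `β ≥ β₀` (plus `Q2 < ε` strictly below `n_ε⁻`).  Asymptotic freedom only says `n_ε⁻` is beyond the
perturbative window; the LOAD of (A) is the UPPER bound on the confinement length in that unit — PROMPT CONFINEMENT (no strongly-correlated but
unconfined range of scales `[n_ε⁻, L_conf∕M]`), i.e. the X-family ∕ confinement-in-units content (census rows 26∕36 re-based at the confinement onset;
row 11 T1), IR and summit-adjacent — NOT Balaban-programme UV content.  It is NECESSARY for PXcof (an admissible unit may sit at the UV end of the
floor, `1∕a(β) ≈ n_ε⁻(β)`; PXcof then wants a pure ⇒ margin-confined box with `L ≤ T·n_ε⁻`), so the stub isolates genuine slot content.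
Why it might fail (live direction): confinement too LATE — a window of scales, growing with `β`, on which plaquette correlations are already strong
(`Q2 ≥ ε`) but no thick box is yet margin-confined (a long crossover); for `SU(N)` none is expected («one scale»: `n_ε⁻ ≍ L_conf ≍ ξ`), but that
expectation IS the open IR content.  (The other direction — confinement while the coupling is still perturbative — is harmless here.)
Tree-adjacent PROVED case: units bounded below (`AfOnset.exists_abs_Q2_le_log_sq`, `exists_beta_forall_abs_Q2_le`); format rung
`afBelowConfinement_rung_bddOnset`. -/
def AFBelowConfinement (η : ℝ) : Prop :=
  ∀ (G : Type) [Group G] [TopologicalSpace G] [IsTopologicalGroup G] [CompactSpace G],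
    IsCompactSimpleLieGroup G → SimplyConnectedSpace G → (∃ z : G, z ∈ Subgroup.center G ∧ z ≠ 1) →
    letI : MeasurableSpace G := borel G
    haveI : BorelSpace G := ⟨rfl⟩
    ∀ (r : LatticeRep G) (v : 𝓢(EuclideanSpace ℝ (Fin 4), ℝ)), tsupport v ⊆ {y : EuclideanSpace ℝ (Fin 4) | 0 < y 0} →
      ∀ ε : ℝ, 0 < ε → ∃ M Λ β₀ : ℝ, ∀ β : ℝ, β₀ ≤ β → ∀ s : ℝ, 0 < s →
        (∃ L₁ : ℕ, 8 ≤ L₁ ∧ MarginConfinedAt r.ρ β L₁ η) →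
        (∀ L' : ℕ, 8 ≤ L' → MarginConfinedAt r.ρ β L' η → M ≤ s * (L' : ℝ)) →
        ∀ L : ℕ, Λ ≤ s * (L : ℝ) → Q2 G r β L s (thetaTest 4 v) v < ε

/-! ## §2 The FIVE stubs (the only sorried declarations): (C), (A), (G), (CF), N_cof -/

/-- stub (C): confinement at every coupling, margin `1∕12`. -/
theorem stub_confinedAtEveryCoupling : ConfinedAtEveryCoupling (1 / 12) := by
  sorry

/-- stub (A): UV control ∧ PROMPT CONFINEMENT in floor units (`L_conf ≤ M·n_ε⁻`), margin `1∕12` (rev 1 label; IR content, necessary for PXcof). -/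
theorem stub_afBelowConfinement : AFBelowConfinement (1 / 12) := by
  sorry

/-- stub (G): margin-confined at `L` ⇒ `1∕24`-pure at `κL` (line 1's located residual, shared token). -/
theorem stub_confinedToPure : ConfinedToPure (1 / 12) (1 / 24) := by
  sorry

/-- stub (CF): PXcof(1∕24) verbatim on the centre-free class (shared token). -/
theorem stub_pxcofCentreFree : PinnedExitsCofinalCentreFreeAt (1 / 24) := by
  sorry

/-- stub N_cof: the slot's second token BY NAME. -/
theorem stub_irnscCof : IRnscCof := by
  sorry

/-! ## §3 PROVED SEAMS: (A) ⇒ (X_conf);  (C) ∧ (X_conf) ⇒ (CU);  (CU) ∧ (G) ∧ (CF) ⇒ PXcof -/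

/-- **The floor is consumed HERE and only here: `AFBelowConfinement η → FloorPinsConfinementOnset η` (PROVED).**  Take the floor's clause (i)
witnesses `v, ε, β₅, Λ₅`; (A) gives `M, Λ, β₀`; the pin is `T = M` beyond `max β₀ β₅`: if at such a `β` some thick box is margin-confined but none fits
under the pin, (A) at unit `s = a(β)` makes `Q2 < ε` on the torus `L = ⌈max Λ Λ₅ ∕ a(β)⌉₊`, where clause (i) says `ε ≤ Q2`. -/
theorem floorPins_of_af {η : ℝ} (hA : AFBelowConfinement η) : FloorPinsConfinementOnset η := by
  intro G _ _ _ _ hGs hsc hZ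
  letI : MeasurableSpace G := borel G
  haveI : BorelSpace G := ⟨rfl⟩
  intro r a ha ha0 hlb
  obtain ⟨⟨v, ε, β₅, Λ₅, hv, hε, hfloor⟩, -⟩ := hlb
  obtain ⟨M, Λ, β₀, hAF⟩ := hA G hGs hsc hZ r v hv ε hε
  refine ⟨M, max β₀ β₅, fun β hβ L hL hconf => ?_⟩
  by_contra hno
  push Not at hno
  have haβ : 0 < a β := ha β
  set Lbig : ℕ := ⌈max Λ Λ₅ / a β⌉₊ with hLbig
  have hbig : max Λ Λ₅ ≤ a β * (Lbig : ℝ) := by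
    have hceil : max Λ Λ₅ / a β ≤ (Lbig : ℝ) := Nat.le_ceil _
    calc max Λ Λ₅ = a β * (max Λ Λ₅ / a β) := by field_simp
      _ ≤ a β * (Lbig : ℝ) := mul_le_mul_of_nonneg_left hceil haβ.le
  have hQ : Q2 G r β Lbig (a β) (thetaTest 4 v) v < ε :=
    hAF β ((le_max_left _ _).trans hβ) (a β) haβ ⟨L, hL, hconf⟩
      (fun L' hL' hc => (hno L' hL' hc).le) Lbig ((le_max_left _ _).trans hbig)
  have hF : ε ≤ Q2 G r β Lbig (a β) (thetaTest 4 v) v :=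
    hfloor β ((le_max_right _ _).trans hβ) Lbig ((le_max_right _ _).trans hbig)
  exact absurd hF (not_le.mpr hQ)

/-- **`(C)(η) ∧ (X_conf)(η) ∧ (G)(η,θ) ∧ (CF)(θ) ⇒ PXcof(θ)` (PROVED).**  Centre non-trivial: at `β = max(β₁, β₀ˣ, β₀ᴳ, 0)` (C) gives a
margin-confined thick box, (X_conf) one under the pin `T`, (G) reads purity at `κ·L'` — pinned by `κT`.  Centre-free: (CF) verbatim. -/
theorem pxcof_of_uvpin {η θ : ℝ} (hC : ConfinedAtEveryCoupling η) (hX : FloorPinsConfinementOnset η) (hG : ConfinedToPure η θ)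
    (hCF : PinnedExitsCofinalCentreFreeAt θ) : PinnedExitsCofinalAt θ := by
  intro G _ _ _ _ hGs hsc
  letI : MeasurableSpace G := borel G
  haveI : BorelSpace G := ⟨rfl⟩
  intro r a ha ha0 hlb
  by_cases hZ : ∃ z : G, z ∈ Subgroup.center G ∧ z ≠ 1
  · obtain ⟨T, β₀, hpin⟩ := hX G hGs hsc hZ r a ha ha0 hlb
    obtain ⟨κ, β₀', hκ, hup⟩ := hG G hGs hsc hZ r
    refine ⟨(κ : ℝ) * T, fun β₁ => ?_⟩
    set β : ℝ := max (max β₁ β₀) (max β₀' 0) with hβdef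
    obtain ⟨L, hL, hconf⟩ := hC G hGs hsc hZ r β ((le_max_right _ _).trans (le_max_right _ _))
    obtain ⟨L', hL', hconf', hpin'⟩ := hpin β ((le_max_right _ _).trans (le_max_left _ _)) L hL hconf
    refine ⟨β, (le_max_left _ _).trans (le_max_left _ _), κ * L', ?_, ?_,
      hup β ((le_max_left _ _).trans (le_max_right _ _)) L' hL' hconf'⟩
    · calc 8 ≤ L' := hL'
        _ = 1 * L' := (one_mul L').symm
        _ ≤ κ * L' := Nat.mul_le_mul_right L' hκ
    · have hk : (0 : ℝ) ≤ (κ : ℝ) := Nat.cast_nonneg κ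
      calc a β * ((κ * L' : ℕ) : ℝ) = (κ : ℝ) * (a β * (L' : ℝ)) := by push_cast; ring
        _ ≤ (κ : ℝ) * T := mul_le_mul_of_nonneg_left hpin' hk
  · push Not at hZ
    exact hCF G hGs hsc hZ r a ha ha0 hlb

/-- **Line 1's token is produced: `(C)(2θ) ∧ (X_conf)(2θ) ∧ (CF)(θ) ⇒ (CU)(2θ)` (PROVED)** — centre non-trivial: modus ponens at the same coupling;
centre-free: S1 (`TwistCost.half_twist_cost_le_coldDefect`) at (CF)'s pinned pure box. -/
theorem pinnedConfinedCofinal_of_pincer {θ : ℝ} (hC : ConfinedAtEveryCoupling (2 * θ)) (hX : FloorPinsConfinementOnset (2 * θ))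
    (hCF : PinnedExitsCofinalCentreFreeAt θ) : PinnedConfinedCofinal (2 * θ) := by
  intro G _ _ _ _ hGs hsc
  letI : MeasurableSpace G := borel G
  haveI : BorelSpace G := ⟨rfl⟩
  intro r a ha ha0 hlb
  by_cases hZ : ∃ z : G, z ∈ Subgroup.center G ∧ z ≠ 1
  · obtain ⟨T, β₀, hpin⟩ := hX G hGs hsc hZ r a ha ha0 hlb
    refine ⟨T, fun β₁ => ?_⟩
    set β : ℝ := max (max β₁ β₀) 0 with hβdef
    obtain ⟨L, hL, hconf⟩ := hC G hGs hsc hZ r β (le_max_right _ _)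
    obtain ⟨L', hL', hconf', hpin'⟩ := hpin β ((le_max_right _ _).trans (le_max_left _ _)) L hL hconf
    exact ⟨β, (le_max_left _ _).trans (le_max_left _ _), L', hL', hpin', hconf'⟩
  · push Not at hZ
    haveI : SecondCountableTopology G :=
      (r.continuous.isClosedEmbedding r.injective).isEmbedding.secondCountableTopology
    obtain ⟨T, hcof⟩ := hCF G hGs hsc hZ r a ha ha0 hlb
    refine ⟨T, fun β₁ => ?_⟩
    obtain ⟨β, hβ, L, hL, hpin, hδ⟩ := hcof (max β₁ 0)
    refine ⟨β, (le_max_left _ _).trans hβ, L, hL, hpin, fun z hz => ?_⟩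
    have h := (half_twist_cost_le_coldDefect r.continuous r.mem_unitary ((le_max_right _ _).trans hβ) hL hz).1
    linarith

/-- **`1∕12 = 2·(1∕24)`: the registered stubs produce line 1's registered (CU).** -/
theorem cu12_of (hC : ConfinedAtEveryCoupling (1 / 12)) (hA : AFBelowConfinement (1 / 12))
    (hCF : PinnedExitsCofinalCentreFreeAt (1 / 24)) : PinnedConfinedCofinal (1 / 12) := by
  have h2 : (2 : ℝ) * (1 / 24) = 1 / 12 := by norm_num
  have h := pinnedConfinedCofinal_of_pincer (θ := 1 / 24) (h2 ▸ hC) (h2 ▸ floorPins_of_af hA) hCF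
  rwa [h2] at h

/-! ## §4 PROVED RUNGS (in-regime, hypothesis-using) -/

/-- **(C) in the Dobrushin corner:** for every compact metrisable `G`, every `r`, every `0 ≤ β ≤ 1∕(216N)`, EVERY thick box `L ≥ max L₀ 8` is
`1∕12`-margin-confined — S1 (half the twist cost ≤ the purity defect) + the landed cold-purity corner at `θ = 1∕24`. -/
theorem confinedAtEveryCoupling_rung_dobrushin :
    ∃ L₀ : ℕ, ∀ (G : Type) [Group G] [TopologicalSpace G] [IsTopologicalGroup G] [CompactSpace G]
      [MeasurableSpace G] [BorelSpace G] (r : LatticeRep G) (β : ℝ), 0 ≤ β → 216 * (r.N : ℝ) * β ≤ 1 →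
      ∀ L : ℕ, max L₀ 8 ≤ L → MarginConfinedAt r.ρ β L (1 / 12) := by
  obtain ⟨L₀, hL₀⟩ := coldExitAt_corner_of_dobrushinTV (θ := 1 / 24) (by norm_num)
  refine ⟨L₀, fun G _ _ _ _ _ _ r β h0 hβ L hL z hz => ?_⟩
  haveI : SecondCountableTopology G :=
    (r.continuous.isClosedEmbedding r.injective).isEmbedding.secondCountableTopology
  have hδ := hL₀ G r β h0 hβ L ((le_max_left _ _).trans hL)
  have h := (half_twist_cost_le_coldDefect r.continuous r.mem_unitary h0 ((le_max_right _ _).trans hL) hz).1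
  linarith

/-- **(C)'s conclusion in the corner** (the `∃ L` form of the stub). -/
theorem confinedAt_of_dobrushin :
    ∀ (G : Type) [Group G] [TopologicalSpace G] [IsTopologicalGroup G] [CompactSpace G]
      [MeasurableSpace G] [BorelSpace G] (r : LatticeRep G) (β : ℝ), 0 ≤ β → 216 * (r.N : ℝ) * β ≤ 1 →
      ∃ L : ℕ, 8 ≤ L ∧ MarginConfinedAt r.ρ β L (1 / 12) := by
  obtain ⟨L₀, h⟩ := confinedAtEveryCoupling_rung_dobrushin
  exact fun G _ _ _ _ _ _ r β h0 hβ => ⟨max L₀ 8, le_max_right _ _, h G r β h0 hβ _ le_rfl⟩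

/-- **(A) at BOUNDED confinement onset (format rung from the tree's lattice-AF theorem):** if the margin-confined box witnessing the hypothesis has
`L₁ ≤ Lmax`, then «every confined box is `≥ M = Lmax` units» forces `s ≥ 1`, and `AfOnset.exists_beta_forall_abs_Q2_le` (units bounded below ⇒
`|Q2| ≤ ε∕2` for `β ≥ β₁`, uniformly in the torus) gives `Q2 < ε`.  The open content of (A) is the complementary regime `L_conf(β) → ∞`. -/
theorem afBelowConfinement_rung_bddOnset (Lmax : ℕ) (η : ℝ) :
    ∀ (G : Type) [Group G] [TopologicalSpace G] [IsTopologicalGroup G] [CompactSpace G]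
      [MeasurableSpace G] [BorelSpace G] (r : LatticeRep G) (v : 𝓢(EuclideanSpace ℝ (Fin 4), ℝ)),
      ∀ ε : ℝ, 0 < ε → ∃ M Λ β₀ : ℝ, ∀ β : ℝ, β₀ ≤ β → ∀ s : ℝ, 0 < s →
        (∃ L₁ : ℕ, 8 ≤ L₁ ∧ L₁ ≤ Lmax ∧ MarginConfinedAt r.ρ β L₁ η) →
        (∀ L' : ℕ, 8 ≤ L' → MarginConfinedAt r.ρ β L' η → M ≤ s * (L' : ℝ)) →
        ∀ L : ℕ, Λ ≤ s * (L : ℝ) → Q2 G r β L s (thetaTest 4 v) v < ε := by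
  intro G _ _ _ _ _ _ r v ε hε
  obtain ⟨β₁, -, hβ₁⟩ := exists_beta_forall_abs_Q2_le r (thetaTest 4 v) v one_pos (half_pos hε)
  refine ⟨(Lmax : ℝ), 1, β₁, fun β hβ s hs hL₁ hall L hL => ?_⟩
  obtain ⟨L₁, h8, hLm, hconf⟩ := hL₁
  have hM : (Lmax : ℝ) ≤ s * (L₁ : ℝ) := hall L₁ h8 hconf
  have hL₁pos : (0 : ℝ) < (L₁ : ℝ) := by exact_mod_cast (show 0 < L₁ by omega)
  have hs1 : 1 ≤ s := by
    have hLm' : (L₁ : ℝ) ≤ (Lmax : ℝ) := by exact_mod_cast hLm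
    nlinarith
  have hLpos : 1 ≤ L := by
    rcases Nat.eq_zero_or_pos L with h | h
    · subst h; simp at hL; linarith
    · exact h
  have hq := hβ₁ β hβ L hLpos s hs1
  have := (abs_le.mp hq).2
  linarith

/-! ## §5 Composition onto the slot: the route decl BY NAME -/

/-- The bill of this line: `(C) → (A) → (G) → (CF) → N_cof → IRcof`. -/
def Bill : Prop :=
  ConfinedAtEveryCoupling (1 / 12) → AFBelowConfinement (1 / 12) → ConfinedToPure (1 / 12) (1 / 24) →
    PinnedExitsCofinalCentreFreeAt (1 / 24) → IRnscCof → Summit.QuantumFields.YangMills.Theses.BalabanLadder.IRcof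

/-- **The composition (PROVED, no sorry):** (A) ⇒ (X_conf) [`floorPins_of_af`]; (C) ∧ (X_conf) ∧ (G) ∧ (CF) ⇒ PXcof(1∕24) [`pxcof_of_uvpin`];
PXcof(1∕24) ⇒ IRscCof [`PinnedExitCofinal.ircofSC_of_pinnedExitsCofinal_le`]; IRscCof ∧ IRnscCof ⇒ IRcof [`RankPurity.IRcof_of_split`]. -/
theorem IRcof_of : Bill := by
  intro hC hA hG hCF hN
  exact IRcof_of_split (ircofSC_of_pinnedExitsCofinal_le (by norm_num) (pxcof_of_uvpin hC (floorPins_of_af hA) hG hCF)) hN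

/-- **The route decl BY NAME from the five stubs** (kernel-checked modulo exactly the stubs). -/
theorem IRcof_of_stubs : Summit.QuantumFields.YangMills.Theses.BalabanLadder.IRcof :=
  IRcof_of stub_confinedAtEveryCoupling stub_afBelowConfinement stub_confinedToPure stub_pxcofCentreFree stub_irnscCof

/-- The slot token PXcof(1∕24) from the stubs. -/
theorem pxcof24_of_stubs : PinnedExitsCofinalAt (1 / 24) :=
  pxcof_of_uvpin stub_confinedAtEveryCoupling (floorPins_of_af stub_afBelowConfinement) stub_confinedToPure stub_pxcofCentreFree

/-- Line 1's token (CU)(1∕12) from the stubs. -/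
theorem cu12_of_stubs : PinnedConfinedCofinal (1 / 12) :=
  cu12_of stub_confinedAtEveryCoupling stub_afBelowConfinement stub_pxcofCentreFree

end Summit.QuantumFields.YangMills.Cruxes.IRcof.UvPin

end
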